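import Literature.Probability.Percolation.LongRangeBridges
import Literature.Probability.Percolation.BondPercolationSymmetry
import Literature.Probability.LatticeModels.ProdBernoulliIndependence
import HarnessLib

/-!
# Long-range bond percolation on `ℤ`: the model, translation invariance, regularity

Topic `Literature/Probability/Percolation`. First probabilistic companion of `LongRangeOneDim.lean`
on the way to the Aizenman–Newman dichotomy `M = 0 ∨ β M² ≥ 1` (Aizenman–Newman 1986,
Prop. 1.1) along the proof of Duminil-Copin–Garban–Tassion (AIHP 60 (2024), §2.4).

## Contents (all proved)

* `edgeProb K e = K_{|x-y|}`, `lrMeasure K = prodBernoulli (edgeProb K)` — the independent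
  translation-invariant bond model on `ℤ` (AN86 (1.1)); it is a probability measure;
* `shiftEdges t`, `exits_shift_iff`, `lrMeasure_real_exits` — translation invariance:
  `P(x exits its R-ball) = P(0 exits its R-ball)`;
* `cutEdges`, `forall_cutEdges_notMem_subset_compl_cross`, `regConst K k = ∏_{d=1}^k (1 - K_d)`,
  `regConst_pos` (regularity `K_d < 1`), `regConst_pow_le_real_compl_cross` — the uniform bound
  `P((cross K c)ᶜ) ≥ m_K^{K²} > 0` used to start the renormalisation (`p̄(C₀) > 0` in DGT).

## References

* M. Aizenman, C. M. Newman, *Discontinuity of the percolation density in one-dimensional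
  `1/|x-y|²` percolation models*, Comm. Math. Phys. 107 (1986) 611–647: §1, Prop. 1.1.
* H. Duminil-Copin, C. Garban, V. Tassion, *Long-range models in 1D revisited*, Ann. Inst.
  H. Poincaré Probab. Statist. 60 (2024), arXiv:2011.04642: §2.4 (Thm. 1(ii), Lemma 3).
-/

noncomputable section

namespace Literature.Probability.Percolation

open MeasureTheory SimpleGraph Literature.Probability.LatticeModels
open scoped ENNReal

/-! ### The translation-invariant long-range model on `ℤ` -/

/-- Edge probabilities `p_{xy} = K_{|x-y|}` of the independent translation-invariant bond model on
`ℤ` (Aizenman–Newman 1986, (1.1); DGT20, §1, `p_{i,j}(β, λ)`).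
[cite: AizenmanNewman1986, §1 (1.1)] -/
def edgeProb (K : ℕ → unitInterval) (e : Sym2 ℤ) : unitInterval := K (edgeLen e)

/-- The law of the independent bond model with `P({x,y} open) = K_{|x-y|}`:
`prodBernoulli (edgeProb K)`. It is propositionally (not definitionally: `funext` + `Sym2.ind`)
equal to the barrier file's `Literature.Barriers.CriticalPhenomena.longRangePercolation K`, which
lifts `K ∘ natAbs` inside `Sym2.lift`; the identification lemma
`longRangePercolation_eq_lrMeasure` is proved in the forthcoming
`Barriers/CriticalPhenomena/LongRangeDiscontinuityProofs.lean` (no topic file imports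
`Barriers/`, hence the topic-level copy here). [cite: AizenmanNewman1986, §1 (1.1)] -/
def lrMeasure (K : ℕ → unitInterval) : Measure (BondConfig ℤ) := prodBernoulli (edgeProb K)

/-- `lrMeasure K` is a probability measure. [folklore] -/
instance instIsProbabilityMeasureLrMeasure (K : ℕ → unitInterval) :
    IsProbabilityMeasure (lrMeasure K) := by
  unfold lrMeasure; infer_instance

/-- `P({x,y} open) = K_{|x-y|}` on a concrete edge. [folklore] -/
@[simp] theorem edgeProb_mk (K : ℕ → unitInterval) (x y : ℤ) :
    edgeProb K s(x, y) = K (x - y).natAbs := rfl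

/-! ### Translation invariance -/

/-- The translation `{x, y} ↦ {x + t, y + t}` of bonds. [folklore] -/
def shiftEdges (t : ℤ) : Sym2 ℤ ≃ Sym2 ℤ := sym2Equiv (Equiv.addRight t)

/-- Translations preserve bond lengths. [folklore] -/
theorem edgeLen_shiftEdges (t : ℤ) (e : Sym2 ℤ) : edgeLen (shiftEdges t e) = edgeLen e := by
  induction e using Sym2.ind with
  | h x y =>
    simp only [shiftEdges, sym2Equiv_mk, Equiv.coe_addRight, edgeLen_mk]
    congr 1; ring

/-- Translations preserve the edge probabilities of the model.
[cite: AizenmanNewman1986, §1 (1.1)] -/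
theorem edgeProb_shiftEdges (K : ℕ → unitInterval) (t : ℤ) (e : Sym2 ℤ) :
    edgeProb K (shiftEdges t e) = edgeProb K e := by
  simp only [edgeProb, edgeLen_shiftEdges]

/-- Exit events are carried to exit events by translations. (The translation `x ↦ x + t` is an
isomorphism of open graphs `openGraph ω ≃g openGraph (shiftEdges t '' ω)`; this is the library's
`openGraphRelabelIso` / `reachable_relabel_iff` of `UniquenessInfiniteCluster.lean`, inlined here
to keep the imports of this file light.) [folklore] -/
theorem exits_shift_iff (R : ℕ) (t : ℤ) (ω : BondConfig ℤ) (x : ℤ) :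
    exits R (shiftEdges t '' ω) (x + t) ↔ exits R ω x := by
  let φ : openGraph ω ≃g openGraph (shiftEdges t '' ω) :=
    { toEquiv := Equiv.addRight t
      map_rel_iff' := fun {a b} => openGraph_relabel_adj_iff (Equiv.addRight t) ω a b }
  have hφ : ∀ u v : ℤ, (openGraph (shiftEdges t '' ω)).Reachable (u + t) (v + t) ↔
      (openGraph ω).Reachable u v := fun u v => φ.reachable_iff (u := u) (v := v)
  constructor
  · rintro ⟨z, hz, hr⟩
    refine ⟨z - t, by omega, ?_⟩
    rw [← hφ, sub_add_cancel]
    exact hr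
  · rintro ⟨z, hz, hr⟩
    exact ⟨z + t, by omega, (hφ x z).2 hr⟩

/-- **Translation invariance of exit probabilities**: `P(x exits its R-ball) = P(0 exits its
R-ball)`. [cite: AizenmanNewman1986, §1 (translation invariance)] -/
theorem lrMeasure_real_exits (K : ℕ → unitInterval) (R : ℕ) (x : ℤ) :
    (lrMeasure K).real {ω | exits R ω x} = (lrMeasure K).real {ω | exits R ω 0} := by
  have h : (fun ω : BondConfig ℤ => shiftEdges (-x) '' ω) ⁻¹' {ω | exits R ω 0} =
      {ω | exits R ω x} := by
    ext ω
    simp only [Set.mem_preimage, Set.mem_setOf_eq]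
    have := exits_shift_iff R (-x) ω x
    rwa [add_neg_cancel] at this
  rw [← h, lrMeasure, prodBernoulli_real_preimage_image_equiv (edgeProb K) (shiftEdges (-x))
    (edgeProb_shiftEdges K (-x)) (measurableSet_exits R 0)]

/-! ### Scale-`K` crossings have probability bounded away from `1` (regularity) -/

/-- The edges of length `≤ K` straddling the cut between `c - 1` and `c`. [folklore] -/
def cutEdges (K : ℕ) (c : ℤ) : Finset (Sym2 ℤ) :=
  ((Finset.Ico (c - K) c ×ˢ Finset.Ico c (c + K)).image fun p : ℤ × ℤ => s(p.1, p.2)).filter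
    fun e => edgeLen e ≤ K

/-- If all cut edges are closed, the block centred at `c` is not `K`-crossed (`K ≥ 1`): the set
`{z < c}` is closed along every open path of window edges. [folklore] -/
theorem forall_cutEdges_notMem_subset_compl_cross {K : ℕ} (hK : 1 ≤ K) (c : ℤ) :
    {ω : BondConfig ℤ | ∀ e ∈ cutEdges K c, e ∉ ω} ⊆ (cross K c)ᶜ := by
  rintro ω hω ⟨x, y, hx, hy, hr⟩
  have hclosed : ∀ a b : ℤ, s(a, b) ∈ hr.some.edges → a ∈ {z : ℤ | z < c} →
      b ∈ {z : ℤ | z < c} := by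
    intro a b hab ha
    have ha' : a < c := ha
    show b < c
    by_contra hb
    push Not at hb
    have hadj := hr.some.adj_of_mem_edges hab
    rw [openGraph_adj] at hadj
    obtain ⟨⟨habω, hw⟩, -⟩ := hadj
    rw [mk_mem_windowEdges_iff] at hw
    refine hω s(a, b) ?_ habω
    simp only [cutEdges, Finset.mem_filter, Finset.mem_image, Finset.mem_product, Finset.mem_Ico,
      Prod.exists, edgeLen_mk_le_iff]
    exact ⟨⟨a, b, ⟨⟨by omega, ha'⟩, hb, by omega⟩, rfl⟩, hw.1⟩
  have hyc : y ∈ {z : ℤ | z < c} :=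
    hr.some.mem_of_edges_closed (S := {z : ℤ | z < c}) (show x < c by omega) hclosed
  have : y < c := hyc
  omega

/-- The regularity constant `m_K = ∏_{d=1}^{K} (1 - K_d) ∈ (0, 1]` (positive iff `K_d < 1` for
`1 ≤ d ≤ K`). [cite: AizenmanNewman1986, §1 (regular models: K_x < 1)] -/
def regConst (K : ℕ → unitInterval) (k : ℕ) : ℝ := ∏ d ∈ Finset.Icc 1 k, (1 - (K d : ℝ))

/-- `0 < m_K` for a regular model. [folklore] -/
theorem regConst_pos {K : ℕ → unitInterval} (hreg : ∀ n : ℕ, 1 ≤ n → K n < 1) (k : ℕ) :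
    0 < regConst K k :=
  Finset.prod_pos fun d hd => sub_pos.2 (hreg d (Finset.mem_Icc.1 hd).1)

/-- `m_K ≤ 1`. [folklore] -/
theorem regConst_le_one (K : ℕ → unitInterval) (k : ℕ) : regConst K k ≤ 1 :=
  Finset.prod_le_one (fun d _ => sub_nonneg.2 (K d).2.2) fun d _ => sub_le_self _ (K d).2.1

/-- Each factor dominates the product: `m_K ≤ 1 - K_d` for `1 ≤ d ≤ K`. [folklore] -/
theorem regConst_le_one_sub {K : ℕ → unitInterval} {k d : ℕ} (hd : d ∈ Finset.Icc 1 k) :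
    regConst K k ≤ 1 - (K d : ℝ) := by
  classical
  rw [regConst, ← Finset.mul_prod_erase _ _ hd]
  exact mul_le_of_le_one_right (sub_nonneg.2 (K d).2.2)
    (Finset.prod_le_one (fun d _ => sub_nonneg.2 (K d).2.2) fun d _ => sub_le_self _ (K d).2.1)

/-- **Uniform lower bound for not being crossed at scale `K`**: for every centre `c`,
`m_K ^ (K²) ≤ P((cross K c)ᶜ)` — close the `≤ K²` cut edges (DGT20, §2.4, where
`p̄(C₀) > 0` is used to pick `C` with `p̄(C₀) ≥ C⁻¹`).
[cite: DuminilcopinGarbanTassion2024, §2.4 (proof of Thm. 1(ii))] -/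
theorem regConst_pow_le_real_compl_cross {K : ℕ → unitInterval} {k : ℕ} (hk : 1 ≤ k) (c : ℤ) :
    regConst K k ^ (k * k) ≤ (lrMeasure K).real (cross k c)ᶜ := by
  classical
  refine le_trans ?_ (measureReal_mono (forall_cutEdges_notMem_subset_compl_cross hk c))
  rw [lrMeasure, prodBernoulli_real_forall_notMem]
  -- each factor is `≥ m_K`, and there are at most `K²` of them
  have hcard : (cutEdges k c).card ≤ k * k := by
    refine le_trans (Finset.card_filter_le _ _) (le_trans Finset.card_image_le ?_)
    rw [Finset.card_product, Int.card_Ico, Int.card_Ico]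
    apply Nat.mul_le_mul <;> omega
  have h0 : 0 ≤ regConst K k := Finset.prod_nonneg fun d _ => sub_nonneg.2 (K d).2.2
  refine le_trans (pow_le_pow_of_le_one h0 (regConst_le_one K k) hcard) ?_
  rw [← Finset.prod_const]
  refine Finset.prod_le_prod (fun _ _ => h0) fun e he => ?_
  simp only [cutEdges, Finset.mem_filter, Finset.mem_image, Finset.mem_product, Finset.mem_Ico,
    Prod.exists] at he
  obtain ⟨⟨a, b, ⟨⟨-, ha⟩, hb, -⟩, rfl⟩, hlen⟩ := he
  refine regConst_le_one_sub (Finset.mem_Icc.2 ⟨?_, hlen⟩)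
  rw [edgeLen_mk]; omega

end Literature.Probability.Percolation
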